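import Mathlib.Analysis.Complex.UpperHalfPlane.Manifold
import Mathlib.NumberTheory.DirichletCharacter.Basic
import Mathlib.NumberTheory.LegendreSymbol.JacobiSymbol
import Mathlib.NumberTheory.ModularForms.CongruenceSubgroups
import Mathlib.NumberTheory.ModularForms.JacobiTheta.OneVariable
import Mathlib.NumberTheory.ModularForms.QExpansion
import HarnessLib

/-!
# Modular forms of half-integral weight (Shimura 1973): the spaces `M_{k/2}(N, χ)`,
# `S_{k/2}(N, χ)`, the Hecke operators `T(p²)` and Waldspurger's subspace `S_{k/2}(N, χ, F)`

Definitions layer for the weight-`3/2` input of Tunnell's theorem (bsd.S29: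
`Literature.Tunnell1983_a/b_sq_eq_const_mul_L_one` in
`Literature.NumberTheory.EllipticCurves.BSDAnalyticRankTunnellWaldspurgerProofs`, which rest on
Tunnell 1983, Theorem 2 — the forms `g θ_t` of weight `3/2` and level `128` are Shimura lifts of
the newform of level `32` — and on Waldspurger's theorem [Waldspurger 1981, Thm 1] as specialised
by Tunnell, p. 328). None of the notions below exist in Mathlib (which has integral weight only:
`ModularForm Γ k`, `k : ℤ`) or elsewhere in this library.

## Contents (namespace `Literature.ModularForms`)

* `shimuraTheta` — `θ(z) = ∑_{n ∈ ℤ} e^{2πi n² z}` (`= jacobiTheta (2z)`), the weight-`1/2`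
  theta function of Shimura (1973), §1; `shimuraTheta_eq_tsum`, `shimuraTheta_vadd_one`
  (`θ(z + 1) = θ(z)`), `mdifferentiable_shimuraTheta`.
* `IsThetaAutomorphic k N χ f` — the automorphy of weight `k/2` (`k` odd), level `N` (`4 ∣ N`)
  and character `χ`: `f(γz) = χ(d) j(γ, z)^k f(z)` for all `γ = (a b; c d) ∈ Γ₀(N)`, where
  `j(γ, z) = θ(γz)/θ(z)` is Shimura's automorphy factor of weight `1/2` (Shimura 1973, §1;
  Koblitz GTM 97, IV §1; Cohen 2019, Def. 7.1: `v_θ(γ)(cτ + d)^{1/2} = θ(γτ)/θ(τ)`). We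
  state it multiplied out, `f(γz) θ(z)^k = χ(d) θ(γz)^k f(z)`, so that no division by `θ(z)` (which
  never vanishes on `ℍ`, a fact we do not need) and no choice of square roots occurs.
* `slashSq k f g z = f(g z)² / (cz + d)^k` for `g = (a b; c d) ∈ SL₂(ℤ)` — the square of
  `(f|[ξ]_k)(z) = f(gz) φ(z)^{-k}` for any `ξ = (g, φ)` of Shimura's covering group over `g`
  (`φ(z)² = t (cz + d)`, `|t| = 1`, Shimura 1973, §1), hence `|slashSq k f g z| = |(f|[ξ]_k)(z)|²: the
  conditions "`f|[ξ]_k` is bounded / tends to `0` at `i∞` for every `ξ` over `SL₂(ℤ)`", i.e.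
  holomorphy / vanishing of `f` at every cusp of `Γ₀(N)` (the cusps are `SL₂(ℤ) · ∞`), are
  `IsBoundedAtImInfty (slashSq k f g)` / `IsZeroAtImInfty (slashSq k f g)` for all `g`; this is
  Cohen's "equivalently, `F²` satisfies the conditions of `M_{2k}(Γ₀(N), χ² χ₋₄)`" (Def. 7.1).
* `halfIntModularForms k N χ`, `halfIntCuspForms k N χ : Submodule ℂ (ℍ → ℂ)` — the spaces
  `M_{k/2}(N, χ) ⊇ S_{k/2}(N, χ)` of Shimura 1973, §1 (denoted `M_k(N, χ)`, `S_k(N, χ)` there,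
  `M_{k/2}(Γ̃₀(N), χ)` in Koblitz): holomorphic on `ℍ`, theta-automorphic, and bounded (resp.
  vanishing) at all cusps.
* `qCoeffs f n = a(n)`, the `n`-th coefficient of the period-`1` `q`-expansion `f = ∑ a(n) qⁿ`
  (Mathlib's `UpperHalfPlane.qExpansion 1`; `T = (1 1; 0 1) ∈ Γ₀(N)` has `d = 1`, so members of
  `M_{k/2}(N, χ)` are `1`-periodic).
* `heckeTSq k χ p : (ℕ → ℂ) →ₗ[ℂ] (ℕ → ℂ)` — the Hecke operator `T(p²)` of weight `k/2` and
  character `χ` **on `q`-expansions**, by Shimura's formula (1973, Thm. 1.7, the formula Tunnell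
  uses on p. 327; Koblitz IV §3):
  if `f = ∑ a(n) qⁿ` then `T(p²) f = ∑ b(n) qⁿ` with
  `b(n) = a(p² n) + χ(p) ((-1)^λ n / p) p^{λ-1} a(n) + χ(p²) p^{k-2} a(n/p²)`, `λ = (k - 1)/2`,
  `a(n/p²) = 0` if `p² ∤ n`. A form is determined by its `q`-expansion, so this is a faithful
  transcription of the operator; that it preserves `M_{k/2}(N, χ)` and `S_{k/2}(N, χ)` (`4 ∣ N`)
  is the content of Theorem 1.7, vendored as the named fact `Shimura1973_heckeTSq_mem`.
* `shimuraSubspace k N χ ev` — **Waldspurger's `S_{k/2}(N, χ, F)`**: the span of the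
  `f ∈ S_{k/2}(N, χ)` with `T(p²) f = λ_p f` for almost all primes `p ∤ N`, where
  `ev p = λ_p` is the Hecke eigenvalue system of a newform `F` of weight `k - 1` ("the forms of
  weight `k/2`, level `N` and character `χ` which correspond to `F` via Shimura's map", Tunnell
  1983 p. 328 (ii); Waldspurger 1981, Thm 1; Purkait 2014, §4.1:
  `S_{k/2}(N, χ, F) = {f ∈ S'_{k/2}(N, χ) : T_{p²} f = λ_p^F f for almost all p ∤ N}`).

## Design notes

* Weight `k/2` is indexed by the odd natural number `k` (Shimura's convention: his `M_k(N, χ)` has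
  weight `k/2`); level `N` should satisfy `4 ∣ N` and `χ` is a Dirichlet character modulo `N`
  (necessarily even on nonzero spaces). For `k` even or `4 ∤ N` the definitions still make sense
  but are not the classical spaces; every named fact carries `Odd k` and `4 ∣ N`.
* The spaces are `Submodule ℂ (ℍ → ℂ)` (not bundled structures), matching the use in Tunnell's
  argument (spans and bases of explicit functions `g θ_t : ℍ → ℂ`).
* `T(p²)` is defined on coefficient sequences `ℕ → ℂ`; "`f` is a `T(p²)`-eigenform with eigenvalue
  `λ`" is `heckeTSq k χ p (qCoeffs f) = λ • qCoeffs f`.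
* For `k = 3` Waldspurger (and Purkait, §4.1) first pass to the orthogonal complement
  `S'_{3/2}(N, χ)` of the one-variable theta series `∑ ψ(m) m q^{t m²}` for the Petersson product.
  When `ev` is the eigenvalue system of a cusp form this restriction is automatic — those theta
  series are `T(p²)`-eigenforms with eigenvalues `ψ(p)(1 + p)` for `p ∤ 4 t cond(ψ)²`, which differ
  from `λ_p(F)` for infinitely many `p` (`|λ_p(F)| ≤ 2√p` in weight `2`), and `T(p²)`, `p ∤ N`, is
  Hermitian — so `shimuraSubspace` omits it; for non-cuspidal `ev` in weight `3/2` the two notions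
  may differ, and no statement here uses that case.

## References

* G. Shimura, *On modular forms of half integral weight*, Ann. of Math. 97 (1973) 440–481: §1
  (the covering group, `θ`, `j(γ, z) = θ(γz)/θ(z)`, the spaces `M_k(N, χ)`, `S_k(N, χ)`), Thm. 1.7
  (action of `T(p²)` on `q`-expansions; the reference `[18, Theorem 1.7]` of Tunnell p. 327). Not
  held; located through Tunnell's and Cohen's accounts.
* H. Cohen, *An introduction to modular forms*, in: Notes from the International Autumn School on
  Computational Number Theory (Inam, Büyükaşık eds.), Birkhäuser 2019, §7.1, Def. 7.1 (PDF p. 54;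
  held): Shimura's definition, `v_θ(γ)(cτ + d)^{1/2} = θ(γτ)/θ(τ)`, and the equivalence of the
  cusp conditions with those of `F²`.
* N. Koblitz, *Introduction to Elliptic Curves and Modular Forms*, GTM 97, Ch. IV §1 (definition),
  §3 (`T_{p²}` on `q`-expansions). Not held.
* J.-L. Waldspurger, *Sur les coefficients de Fourier des formes modulaires de poids demi-entier*,
  J. Math. Pures Appl. 60 (1981) 375–484, Thm 1 (the spaces `S_{k/2}(N, χ, F)`).
* S. Purkait, *A note on the Fourier coefficients of half-integral weight modular forms*, Arch.
  Math. 102 (2014) 369–378 (arXiv:1304.6586), §4.1 (restatement of the definition of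
  `S_{k/2}(N, χ, F)`; held).
* J. B. Tunnell, *A classical Diophantine problem and modular forms of weight 3/2*, Invent. Math.
  72 (1983) 323–334, p. 325 (Shimura's map, `T(p²)`), p. 328 (Theorem (Waldspurger) (ii)).
-/

noncomputable section

open scoped MatrixGroups Manifold

open UpperHalfPlane CongruenceSubgroup Complex Filter Topology

namespace Literature.NumberTheory.EllipticCurves.ModularForms

/-! ### Shimura's theta function `θ(z) = ∑ e^{2πi n² z}` -/

/-- **Shimura's theta function** `θ(z) = ∑_{n ∈ ℤ} e^{2πi n² z}` on `ℍ`, i.e. Mathlib's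
`jacobiTheta (2z)` (`jacobiTheta τ = ∑ e^{πi n² τ}`); the basic modular form of weight `1/2` and
level `4` whose quotients `θ(γz)/θ(z)`, `γ ∈ Γ₀(4)`, define the automorphy factor of half-integral
weight. [cite: Shimura1973HalfIntegral, §1] [cite: Cohen2019IntroModularForms, §7.1] -/
def shimuraTheta (z : ℍ) : ℂ :=
  jacobiTheta (2 * (z : ℂ))

/-- `θ(z) = ∑_{n ∈ ℤ} e^{2πi n² z}`. [folklore] -/
theorem shimuraTheta_eq_tsum (z : ℍ) :
    shimuraTheta z = ∑' n : ℤ, cexp (2 * Real.pi * Complex.I * (n : ℂ) ^ 2 * z) := by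
  unfold shimuraTheta jacobiTheta
  congr 1 with n
  ring_nf

/-- `θ(z + 1) = θ(z)`. [folklore] -/
theorem shimuraTheta_vadd_one (z : ℍ) : shimuraTheta ((1 : ℝ) +ᵥ z) = shimuraTheta z := by
  unfold shimuraTheta
  rw [coe_vadd, ofReal_one, mul_add, mul_one]
  exact jacobiTheta_two_add _

/-- `θ(T • z) = θ(z)` for `T = (1 1; 0 1)`. [folklore] -/
theorem shimuraTheta_T_smul (z : ℍ) : shimuraTheta (ModularGroup.T • z) = shimuraTheta z := by
  rw [modular_T_smul, shimuraTheta_vadd_one]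

/-- `θ` is holomorphic on `ℍ`. [folklore] -/
theorem mdifferentiable_shimuraTheta : MDiff shimuraTheta := by
  rw [UpperHalfPlane.mdifferentiable_iff]
  intro w hw
  have h2 : 0 < (2 * w).im := by simpa using hw
  have hd : DifferentiableAt ℂ (fun w : ℂ ↦ jacobiTheta (2 * w)) w :=
    (differentiableAt_jacobiTheta h2).comp w (differentiableAt_id.const_mul _)
  refine (hd.congr_of_eventuallyEq ?_).differentiableWithinAt
  filter_upwards [(Complex.continuous_im.isOpen_preimage _ isOpen_Ioi).mem_nhds hw] with u hu
  simp only [Function.comp_apply, shimuraTheta, ofComplex_apply_of_im_pos hu, UpperHalfPlane.coe_mk]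

/-! ### Automorphy of weight `k/2` and the conditions at the cusps -/

/-- **Automorphy of weight `k/2`, level `N`, character `χ`** (Shimura): for every
`γ = (a b; c d) ∈ Γ₀(N)` and `z ∈ ℍ`, `f(γz) = χ(d) j(γ, z)^k f(z)` with
`j(γ, z) = θ(γz)/θ(z)` (`= ε_d⁻¹ (c/d) (cz + d)^{1/2}`), written multiplied out as
`f(γz) θ(z)^k = χ(d) θ(γz)^k f(z)`. Intended for `k` odd and `4 ∣ N` (so that `Γ₀(N) ≤ Γ₀(4)`).
[cite: Shimura1973HalfIntegral, §1] [cite: Cohen2019IntroModularForms, Def. 7.1] -/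
def IsThetaAutomorphic (k N : ℕ) (χ : DirichletCharacter ℂ N) (f : ℍ → ℂ) : Prop :=
  ∀ γ ∈ Gamma0 N, ∀ z : ℍ,
    f (γ • z) * shimuraTheta z ^ k = χ ((γ 1 1 : ℤ) : ZMod N) * shimuraTheta (γ • z) ^ k * f z

/-- `f(gz)² / (cz + d)^k` for `g = (a b; c d) ∈ SL₂(ℤ)`: the square of `(f|[ξ]_k)(z) = f(gz) φ(z)^{-k}`
for any element `ξ = (g, φ)` (`φ(z)² = ±(cz + d)`) of Shimura's covering group above `g`, so that
`|slashSq k f g z| = |(f|[ξ]_k)(z)|²`; used to express the behaviour of `f` at the cusp `g · ∞`.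
[cite: Shimura1973HalfIntegral, §1] [cite: Cohen2019IntroModularForms, Def. 7.1] -/
def slashSq (k : ℕ) (f : ℍ → ℂ) (g : SL(2, ℤ)) (z : ℍ) : ℂ :=
  f (g • z) ^ 2 / denom g z ^ k

/-- `|f(gz)²/(cz + d)^k| = |f(gz)|² / |cz + d|^k`. [folklore] -/
theorem norm_slashSq (k : ℕ) (f : ℍ → ℂ) (g : SL(2, ℤ)) (z : ℍ) :
    ‖slashSq k f g z‖ = ‖f (g • z)‖ ^ 2 / ‖denom g z‖ ^ k := by
  simp [slashSq, norm_pow]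

/-- `slashSq` of the zero function. [folklore] -/
@[simp] theorem slashSq_zero (k : ℕ) (g : SL(2, ℤ)) : slashSq k 0 g = 0 := by
  funext z
  simp [slashSq]

/-- `slashSq` is quadratic: `slashSq (c f) = c² slashSq f`. [folklore] -/
theorem slashSq_smul (k : ℕ) (c : ℂ) (f : ℍ → ℂ) (g : SL(2, ℤ)) :
    slashSq k (c • f) g = (c ^ 2) • slashSq k f g := by
  funext z
  simp only [slashSq, Pi.smul_apply, smul_eq_mul]
  ring

/-- `|slashSq (f₁ + f₂)| ≤ 2 |slashSq f₁| + 2 |slashSq f₂|` (from `|a + b|² ≤ 2|a|² + 2|b|²`). [folklore] -/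
theorem norm_slashSq_add_le (k : ℕ) (f₁ f₂ : ℍ → ℂ) (g : SL(2, ℤ)) (z : ℍ) :
    ‖slashSq k (f₁ + f₂) g z‖ ≤ 2 * ‖slashSq k f₁ g z‖ + 2 * ‖slashSq k f₂ g z‖ := by
  simp only [norm_slashSq, Pi.add_apply]
  have hd : 0 ≤ ‖denom (g : GL (Fin 2) ℝ) z‖ ^ k := by positivity
  rw [← mul_div_assoc, ← mul_div_assoc, ← add_div]
  apply div_le_div_of_nonneg_right _ hd
  have h1 : ‖f₁ (g • z) + f₂ (g • z)‖ ^ 2 ≤ (‖f₁ (g • z)‖ + ‖f₂ (g • z)‖) ^ 2 := by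
    gcongr
    exact norm_add_le _ _
  nlinarith [h1, sq_nonneg (‖f₁ (g • z)‖ - ‖f₂ (g • z)‖)]

/-- Vanishing of `slashSq` at `i∞` is preserved under sums of functions. [folklore] -/
theorem isZeroAtImInfty_slashSq_add {k : ℕ} {f₁ f₂ : ℍ → ℂ} {g : SL(2, ℤ)}
    (h₁ : IsZeroAtImInfty (slashSq k f₁ g)) (h₂ : IsZeroAtImInfty (slashSq k f₂ g)) :
    IsZeroAtImInfty (slashSq k (f₁ + f₂) g) := by
  rw [isZeroAtImInfty_iff] at h₁ h₂ ⊢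
  intro ε hε
  obtain ⟨A₁, hA₁⟩ := h₁ (ε / 4) (by positivity)
  obtain ⟨A₂, hA₂⟩ := h₂ (ε / 4) (by positivity)
  refine ⟨max A₁ A₂, fun z hz ↦ ?_⟩
  have e₁ := hA₁ z ((le_max_left _ _).trans hz)
  have e₂ := hA₂ z ((le_max_right _ _).trans hz)
  linarith [norm_slashSq_add_le k f₁ f₂ g z]

/-- Boundedness of `slashSq` at `i∞` is preserved under sums of functions. [folklore] -/
theorem isBoundedAtImInfty_slashSq_add {k : ℕ} {f₁ f₂ : ℍ → ℂ} {g : SL(2, ℤ)}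
    (h₁ : IsBoundedAtImInfty (slashSq k f₁ g)) (h₂ : IsBoundedAtImInfty (slashSq k f₂ g)) :
    IsBoundedAtImInfty (slashSq k (f₁ + f₂) g) := by
  rw [isBoundedAtImInfty_iff] at h₁ h₂ ⊢
  obtain ⟨M₁, A₁, hA₁⟩ := h₁
  obtain ⟨M₂, A₂, hA₂⟩ := h₂
  refine ⟨2 * M₁ + 2 * M₂, max A₁ A₂, fun z hz ↦ ?_⟩
  have e₁ := hA₁ z ((le_max_left _ _).trans hz)
  have e₂ := hA₂ z ((le_max_right _ _).trans hz)
  linarith [norm_slashSq_add_le k f₁ f₂ g z]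

/-! ### The spaces `M_{k/2}(N, χ)` and `S_{k/2}(N, χ)` -/

/-- **`M_{k/2}(N, χ)`, modular forms of half-integral weight `k/2`** (`k` odd), level `N`
(`4 ∣ N`) and character `χ` (Shimura 1973, §1, there written `M_k(N, χ)`): functions
`f : ℍ → ℂ` that are holomorphic, satisfy `f(γz) = χ(d) j(γ, z)^k f(z)` for `γ ∈ Γ₀(N)`
(`IsThetaAutomorphic`), and are holomorphic at every cusp: `f|[ξ]_k` is bounded at `i∞` for every
`ξ` over `SL₂(ℤ)`, i.e. `f(gz)²/(cz + d)^k` is bounded at `i∞` for every `g ∈ SL₂(ℤ)`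
(equivalently `f²` satisfies the cusp conditions of weight `k`, Cohen Def. 7.1).
[cite: Shimura1973HalfIntegral, §1] [cite: Cohen2019IntroModularForms, Def. 7.1] -/
def halfIntModularForms (k N : ℕ) (χ : DirichletCharacter ℂ N) : Submodule ℂ (ℍ → ℂ) where
  carrier := {f | MDiff f ∧ IsThetaAutomorphic k N χ f ∧
    ∀ g : SL(2, ℤ), IsBoundedAtImInfty (slashSq k f g)}
  zero_mem' := ⟨mdifferentiable_const, fun γ _ z ↦ by simp,
    fun g ↦ by rw [slashSq_zero]; exact zero_form_isBoundedAtImInfty⟩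
  add_mem' := by
    rintro f₁ f₂ ⟨hd₁, ha₁, hc₁⟩ ⟨hd₂, ha₂, hc₂⟩
    refine ⟨hd₁.add hd₂, fun γ hγ z ↦ ?_, fun g ↦ isBoundedAtImInfty_slashSq_add (hc₁ g) (hc₂ g)⟩
    simp only [Pi.add_apply]
    linear_combination ha₁ γ hγ z + ha₂ γ hγ z
  smul_mem' := by
    rintro c f ⟨hd, ha, hc⟩
    refine ⟨hd.const_smul c, fun γ hγ z ↦ ?_, fun g ↦ ?_⟩
    · simp only [Pi.smul_apply, smul_eq_mul]
      linear_combination c * ha γ hγ z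
    · rw [slashSq_smul]
      exact (hc g).const_smul_left (c ^ 2)

/-- **`S_{k/2}(N, χ)`, cusp forms of half-integral weight `k/2`** (`k` odd), level `N` (`4 ∣ N`)
and character `χ` (Shimura 1973, §1, `S_k(N, χ)`): holomorphic, theta-automorphic of weight
`k/2` for `Γ₀(N)` with character `χ`, and vanishing at every cusp: `f(gz)²/(cz + d)^k → 0` at `i∞`
for every `g = (a b; c d) ∈ SL₂(ℤ)` (i.e. `f|[ξ]_k → 0` at `i∞` for every `ξ` over `SL₂(ℤ)`;
equivalently `f²` satisfies the cusp-form conditions of weight `k`, Cohen Def. 7.1).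
[cite: Shimura1973HalfIntegral, §1] [cite: Cohen2019IntroModularForms, Def. 7.1] -/
def halfIntCuspForms (k N : ℕ) (χ : DirichletCharacter ℂ N) : Submodule ℂ (ℍ → ℂ) where
  carrier := {f | MDiff f ∧ IsThetaAutomorphic k N χ f ∧
    ∀ g : SL(2, ℤ), IsZeroAtImInfty (slashSq k f g)}
  zero_mem' := ⟨mdifferentiable_const, fun γ _ z ↦ by simp,
    fun g ↦ by rw [slashSq_zero]; exact zero_zeroAtFilter _⟩
  add_mem' := by
    rintro f₁ f₂ ⟨hd₁, ha₁, hc₁⟩ ⟨hd₂, ha₂, hc₂⟩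
    refine ⟨hd₁.add hd₂, fun γ hγ z ↦ ?_, fun g ↦ isZeroAtImInfty_slashSq_add (hc₁ g) (hc₂ g)⟩
    simp only [Pi.add_apply]
    linear_combination ha₁ γ hγ z + ha₂ γ hγ z
  smul_mem' := by
    rintro c f ⟨hd, ha, hc⟩
    refine ⟨hd.const_smul c, fun γ hγ z ↦ ?_, fun g ↦ ?_⟩
    · simp only [Pi.smul_apply, smul_eq_mul]
      linear_combination c * ha γ hγ z
    · rw [slashSq_smul]
      exact (hc g).smul (c ^ 2)

/-- Unfolding membership in `M_{k/2}(N, χ)`. [folklore] -/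
theorem mem_halfIntModularForms_iff {k N : ℕ} {χ : DirichletCharacter ℂ N} {f : ℍ → ℂ} :
    f ∈ halfIntModularForms k N χ ↔ MDiff f ∧ IsThetaAutomorphic k N χ f ∧
      ∀ g : SL(2, ℤ), IsBoundedAtImInfty (slashSq k f g) :=
  Iff.rfl

/-- Unfolding membership in `S_{k/2}(N, χ)`. [folklore] -/
theorem mem_halfIntCuspForms_iff {k N : ℕ} {χ : DirichletCharacter ℂ N} {f : ℍ → ℂ} :
    f ∈ halfIntCuspForms k N χ ↔ MDiff f ∧ IsThetaAutomorphic k N χ f ∧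
      ∀ g : SL(2, ℤ), IsZeroAtImInfty (slashSq k f g) :=
  Iff.rfl

/-- `S_{k/2}(N, χ) ≤ M_{k/2}(N, χ)`. [folklore] -/
theorem halfIntCuspForms_le_halfIntModularForms (k N : ℕ) (χ : DirichletCharacter ℂ N) :
    halfIntCuspForms k N χ ≤ halfIntModularForms k N χ :=
  fun _ ⟨hd, ha, hc⟩ ↦ ⟨hd, ha, fun g ↦ (hc g).isBoundedAtImInfty⟩


/-! ### Periodicity and `q`-expansions -/

/-- `T = (1 1; 0 1) ∈ Γ₀(N)`. [folklore] -/
theorem modularT_mem_Gamma0 (N : ℕ) : ModularGroup.T ∈ Gamma0 N := by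
  simp [Gamma0_mem, ModularGroup.coe_T]

/-- `θ(i) ≠ 0` (indeed `|θ(i) - 1| ≤ 2e^{-2π}/(1 - e^{-2π}) < 1`). [folklore] -/
theorem shimuraTheta_I_ne_zero : shimuraTheta UpperHalfPlane.I ≠ 0 := by
  unfold shimuraTheta
  have him : (2 * ((UpperHalfPlane.I : ℍ) : ℂ)).im = 2 := by simp
  have hpos : 0 < (2 * ((UpperHalfPlane.I : ℍ) : ℂ)).im := by rw [him]; norm_num
  have hb := norm_jacobiTheta_sub_one_le hpos
  rw [him] at hb
  set r : ℝ := Real.exp (-Real.pi * 2) with hr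
  have hr0 : 0 < r := Real.exp_pos _
  have hr3 : r < 1 / 3 := by
    have h3 : (3 : ℝ) < Real.exp (Real.pi * 2) := by
      have := Real.add_one_le_exp (Real.pi * 2)
      nlinarith [Real.two_le_pi]
    have : r = (Real.exp (Real.pi * 2))⁻¹ := by rw [hr, ← Real.exp_neg]; ring_nf
    rw [this, one_div, inv_lt_inv₀ (Real.exp_pos _) (by norm_num)]
    exact h3
  have hlt : 2 / (1 - r) * r < 1 := by
    rw [div_mul_eq_mul_div, div_lt_one (by linarith)]
    linarith
  intro h0
  rw [h0, zero_sub, norm_neg, norm_one] at hb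
  linarith

/-- **Forms of half-integral weight are `1`-periodic**: if `f` is holomorphic and
theta-automorphic for `Γ₀(N)` then `f(z + 1) = f(z)` (apply the automorphy to `T = (1 1; 0 1)`,
`d = 1`, `θ(z + 1) = θ(z)`, to get `(f(z + 1) - f(z)) θ(z)^k = 0`, and use the identity theorem:
`θ(i) ≠ 0`). [folklore] -/
theorem IsThetaAutomorphic.vadd_one {k N : ℕ} {χ : DirichletCharacter ℂ N} {f : ℍ → ℂ}
    (ha : IsThetaAutomorphic k N χ f) (hf : MDiff f) (z : ℍ) : f ((1 : ℝ) +ᵥ z) = f z := by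
  -- Step 1: `(f(z + 1) - f z) θ(z)^k = 0`.
  have h1 : ∀ w : ℍ, (f ((1 : ℝ) +ᵥ w) - f w) * shimuraTheta w ^ k = 0 := by
    intro w
    have h := ha ModularGroup.T (modularT_mem_Gamma0 N) w
    rw [modular_T_smul, shimuraTheta_vadd_one] at h
    have hT : (((ModularGroup.T : SL(2, ℤ)) 1 1 : ℤ) : ZMod N) = 1 := by
      simp [ModularGroup.coe_T]
    rw [hT, map_one, one_mul] at h
    linear_combination h
  -- Step 2: the identity theorem for `G(w) = f(w + 1) - f(w)` on the upper half-plane.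
  set F : ℂ → ℂ := f ∘ ofComplex with hF
  set G : ℂ → ℂ := fun w ↦ F (1 + w) - F w with hG
  have hU : IsOpen upperHalfPlaneSet := isOpen_upperHalfPlaneSet
  have hFd : DifferentiableOn ℂ F upperHalfPlaneSet := UpperHalfPlane.mdifferentiable_iff.mp hf
  have him1 : ∀ w : ℂ, (1 + w).im = w.im := fun w ↦ by simp
  have hGd : DifferentiableOn ℂ G upperHalfPlaneSet := by
    refine DifferentiableOn.sub (fun w hw ↦ ?_) hFd
    have h1w : (1 + w) ∈ upperHalfPlaneSet := by
      show 0 < (1 + w).im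
      rw [him1]; exact hw
    exact ((hFd (1 + w) h1w).differentiableAt (hU.mem_nhds h1w)).comp_differentiableWithinAt w
      ((differentiableAt_id.const_add (1 : ℂ)).differentiableWithinAt)
  have hGa : AnalyticOnNhd ℂ G upperHalfPlaneSet := hGd.analyticOnNhd hU
  have hoc1 : ∀ {w : ℂ} (hw : 0 < w.im),
      ofComplex (1 + w) = (1 : ℝ) +ᵥ (⟨w, hw⟩ : ℍ) := by
    intro w hw
    have h1w : 0 < (1 + w).im := by rw [him1]; exact hw
    rw [ofComplex_apply_of_im_pos h1w]
    ext
    simp [coe_vadd]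
  have hGΘ : ∀ w ∈ upperHalfPlaneSet, G w * shimuraTheta (ofComplex w) ^ k = 0 := by
    intro w hw
    have hw' : 0 < w.im := hw
    simp only [hG, hF, Function.comp_apply, hoc1 hw', ofComplex_apply_of_im_pos hw']
    exact h1 ⟨w, hw'⟩
  have hIim : 0 < Complex.I.im := by simp
  have hI : Complex.I ∈ upperHalfPlaneSet := hIim
  have hΘd : DifferentiableOn ℂ (shimuraTheta ∘ ofComplex) upperHalfPlaneSet :=
    UpperHalfPlane.mdifferentiable_iff.mp mdifferentiable_shimuraTheta
  have hΘcont : ContinuousAt (shimuraTheta ∘ ofComplex) Complex.I :=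
    ((hΘd _ hI).differentiableAt (hU.mem_nhds hI)).continuousAt
  have hΘI : (shimuraTheta ∘ ofComplex) Complex.I ≠ 0 := by
    simp only [Function.comp_apply, ofComplex_apply_of_im_pos hIim]
    exact shimuraTheta_I_ne_zero
  have hev : G =ᶠ[𝓝 Complex.I] 0 := by
    filter_upwards [hΘcont.eventually_ne hΘI, hU.mem_nhds hI] with w hw hwU
    exact (mul_eq_zero.mp (hGΘ w hwU)).resolve_right (pow_ne_zero _ hw)
  have hG0 : Set.EqOn G 0 upperHalfPlaneSet :=
    hGa.eqOn_zero_of_preconnected_of_eventuallyEq_zero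
      (convex_halfSpace_im_gt 0).isPreconnected hI hev
  -- Step 3: evaluate at `z`.
  have hz := hG0 (z.im_pos : (z : ℂ) ∈ upperHalfPlaneSet)
  simp only [hG, hF, Function.comp_apply, Pi.zero_apply, sub_eq_zero, hoc1 z.im_pos,
    ofComplex_apply] at hz
  exact hz

/-- Holomorphic theta-automorphic functions are `1`-periodic as functions on `ℂ` (through
Mathlib's `ofComplex`), the form needed by `UpperHalfPlane.hasSum_qExpansion`. [folklore] -/
theorem IsThetaAutomorphic.periodic_comp_ofComplex {k N : ℕ} {χ : DirichletCharacter ℂ N}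
    {f : ℍ → ℂ} (ha : IsThetaAutomorphic k N χ f) (hf : MDiff f) :
    Function.Periodic (f ∘ ofComplex) (1 : ℝ) := by
  intro w
  by_cases hw : 0 < w.im
  · have h1w : 0 < (w + (1 : ℝ)).im := by simpa using hw
    simp only [Function.comp_apply]
    rw [ofComplex_apply_of_im_pos h1w, ofComplex_apply_of_im_pos hw]
    have : (⟨w + (1 : ℝ), h1w⟩ : ℍ) = (1 : ℝ) +ᵥ ⟨w, hw⟩ := by
      ext
      simp [coe_vadd, add_comm]
    rw [this, ha.vadd_one hf]
  · simp only [Function.comp_apply]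
    rw [ofComplex_apply_eq_of_im_nonpos (by simpa using not_lt.mp hw) (not_lt.mp hw)]

/-- At `g = 1` (the cusp `∞`), `slashSq k f 1 = f²`. [folklore] -/
theorem slashSq_one (k : ℕ) (f : ℍ → ℂ) : slashSq k f 1 = fun z ↦ f z ^ 2 := by
  funext z
  simp [slashSq]

/-- A function with `f²` bounded at `i∞` is bounded at `i∞`. [folklore] -/
theorem isBoundedAtImInfty_of_slashSq_one {k : ℕ} {f : ℍ → ℂ}
    (h : IsBoundedAtImInfty (slashSq k f 1)) : IsBoundedAtImInfty f := by
  rw [slashSq_one] at h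
  rw [isBoundedAtImInfty_iff] at h ⊢
  obtain ⟨M, A, hM⟩ := h
  refine ⟨Real.sqrt M, A, fun z hz ↦ ?_⟩
  have h2 : ‖f z‖ ^ 2 ≤ M := by simpa [norm_pow] using hM z hz
  calc ‖f z‖ = Real.sqrt (‖f z‖ ^ 2) := (Real.sqrt_sq (norm_nonneg _)).symm
    _ ≤ Real.sqrt M := Real.sqrt_le_sqrt h2

/-- A function with `f² → 0` at `i∞` tends to `0` at `i∞`. [folklore] -/
theorem isZeroAtImInfty_of_slashSq_one {k : ℕ} {f : ℍ → ℂ}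
    (h : IsZeroAtImInfty (slashSq k f 1)) : IsZeroAtImInfty f := by
  rw [slashSq_one] at h
  rw [isZeroAtImInfty_iff] at h ⊢
  intro ε hε
  obtain ⟨A, hA⟩ := h (ε ^ 2) (by positivity)
  refine ⟨A, fun z hz ↦ ?_⟩
  have h2 : ‖f z‖ ^ 2 ≤ ε ^ 2 := by simpa [norm_pow] using hA z hz
  calc ‖f z‖ = Real.sqrt (‖f z‖ ^ 2) := (Real.sqrt_sq (norm_nonneg _)).symm
    _ ≤ Real.sqrt (ε ^ 2) := Real.sqrt_le_sqrt h2
    _ = ε := Real.sqrt_sq hε.le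

/-- Members of `M_{k/2}(N, χ)` are bounded at `i∞`. [folklore] -/
theorem isBoundedAtImInfty_of_mem_halfIntModularForms {k N : ℕ} {χ : DirichletCharacter ℂ N}
    {f : ℍ → ℂ} (hf : f ∈ halfIntModularForms k N χ) : IsBoundedAtImInfty f :=
  isBoundedAtImInfty_of_slashSq_one (hf.2.2 1)

/-- Members of `S_{k/2}(N, χ)` tend to `0` at `i∞`. [folklore] -/
theorem isZeroAtImInfty_of_mem_halfIntCuspForms {k N : ℕ} {χ : DirichletCharacter ℂ N}
    {f : ℍ → ℂ} (hf : f ∈ halfIntCuspForms k N χ) : IsZeroAtImInfty f :=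
  isZeroAtImInfty_of_slashSq_one (hf.2.2 1)

/-- The **`q`-expansion coefficients** `a(n)` of `f = ∑_{n ≥ 0} a(n) qⁿ`, `q = e^{2πiz}`: Mathlib's
period-`1` `qExpansion`. Meaningful for `1`-periodic holomorphic `f` bounded at `i∞`, e.g. every
member of `M_{k/2}(N, χ)` (`hasSum_qCoeffs`). [folklore] -/
def qCoeffs (f : ℍ → ℂ) (n : ℕ) : ℂ :=
  (qExpansion 1 f).coeff n

/-- Unfolding `qCoeffs`. [folklore] -/
theorem qCoeffs_apply (f : ℍ → ℂ) (n : ℕ) : qCoeffs f n = (qExpansion 1 f).coeff n := rfl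

/-- The zero function has zero `q`-expansion. [folklore] -/
@[simp] theorem qCoeffs_zero : qCoeffs 0 = 0 := by
  funext n
  simp [qCoeffs, qExpansion_zero]

/-- The cusp function `F(q)`, `f(z) = F(e^{2πiz})`, of a member of `M_{k/2}(N, χ)` is analytic at
`q = 0`. [folklore] -/
theorem analyticAt_cuspFunction_of_mem {k N : ℕ} {χ : DirichletCharacter ℂ N} {f : ℍ → ℂ}
    (hf : f ∈ halfIntModularForms k N χ) : AnalyticAt ℂ (cuspFunction 1 f) 0 :=
  analyticAt_cuspFunction_zero one_pos (hf.2.1.periodic_comp_ofComplex hf.1) hf.1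
    (isBoundedAtImInfty_of_mem_halfIntModularForms hf)

/-- **`q`-expansion** of a modular form of half-integral weight: `f(z) = ∑_{n ≥ 0} a(n) e^{2πinz}`
for `f ∈ M_{k/2}(N, χ)`. [folklore] -/
theorem hasSum_qCoeffs {k N : ℕ} {χ : DirichletCharacter ℂ N} {f : ℍ → ℂ}
    (hf : f ∈ halfIntModularForms k N χ) (z : ℍ) :
    HasSum (fun n : ℕ ↦ qCoeffs f n * Function.Periodic.qParam 1 z ^ n) (f z) := by
  simpa [qCoeffs, smul_eq_mul] using hasSum_qExpansion one_pos
    (hf.2.1.periodic_comp_ofComplex hf.1) hf.1 (isBoundedAtImInfty_of_mem_halfIntModularForms hf) z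

/-- `q`-expansion coefficients are additive on `M_{k/2}(N, χ)`. [folklore] -/
theorem qCoeffs_add {k N : ℕ} {χ : DirichletCharacter ℂ N} {f g : ℍ → ℂ}
    (hf : f ∈ halfIntModularForms k N χ) (hg : g ∈ halfIntModularForms k N χ) :
    qCoeffs (f + g) = qCoeffs f + qCoeffs g := by
  funext n
  simp [qCoeffs, qExpansion_add (analyticAt_cuspFunction_of_mem hf)
    (analyticAt_cuspFunction_of_mem hg)]

/-- `q`-expansion coefficients are homogeneous on `M_{k/2}(N, χ)`. [folklore] -/
theorem qCoeffs_smul {k N : ℕ} {χ : DirichletCharacter ℂ N} {f : ℍ → ℂ}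
    (hf : f ∈ halfIntModularForms k N χ) (c : ℂ) : qCoeffs (c • f) = c • qCoeffs f := by
  funext n
  simp [qCoeffs, qExpansion_smul (analyticAt_cuspFunction_of_mem hf) c]

/-- The `q`-expansion map `M_{k/2}(N, χ) →ₗ[ℂ] (ℕ → ℂ)`. [folklore] -/
def qCoeffsₗ (k N : ℕ) (χ : DirichletCharacter ℂ N) : halfIntModularForms k N χ →ₗ[ℂ] (ℕ → ℂ) where
  toFun f := qCoeffs (f : ℍ → ℂ)
  map_add' f g := qCoeffs_add f.2 g.2
  map_smul' c f := qCoeffs_smul f.2 c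

/-- Unfolding `qCoeffsₗ`. [folklore] -/
@[simp] theorem qCoeffsₗ_apply (k N : ℕ) (χ : DirichletCharacter ℂ N)
    (f : halfIntModularForms k N χ) : qCoeffsₗ k N χ f = qCoeffs (f : ℍ → ℂ) := rfl

/-- A member of `M_{k/2}(N, χ)` with vanishing `q`-expansion is `0`. [folklore] -/
theorem eq_zero_of_qCoeffs_eq_zero {k N : ℕ} {χ : DirichletCharacter ℂ N} {f : ℍ → ℂ}
    (hf : f ∈ halfIntModularForms k N χ) (h : qCoeffs f = 0) : f = 0 := by
  refine (qExpansion_eq_zero_iff one_pos (hf.2.1.periodic_comp_ofComplex hf.1) hf.1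
    (isBoundedAtImInfty_of_mem_halfIntModularForms hf)).mp ?_
  ext n
  simpa [qCoeffs] using congr_fun h n

/-! ### Hecke operators `T(p²)` on `q`-expansions (Shimura 1973, Thm. 1.7) -/

/-- **The Hecke operator `T(p²)` of weight `k/2` and character `χ` on `q`-expansions** (Shimura
1973, Thm. 1.7; Koblitz IV §3): `(T(p²) a)(n) = a(p² n) + χ(p) ((-1)^λ n / p) p^{λ-1} a(n)
+ χ(p²) p^{k-2} a(n/p²)` with `λ = (k - 1)/2` and `a(n/p²) = 0` when `p² ∤ n`; here
`((-1)^λ n / p)` is the quadratic residue symbol (Mathlib `jacobiSym`, `= (-1/p)^λ (n/p)` for odd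
`p`). For `p ∣ N` one has `χ(p) = 0` and `T(p²) a = (n ↦ a(p² n))`. Intended for `k` odd, `p`
prime. [cite: Shimura1973HalfIntegral, Thm. 1.7] -/
def heckeTSq (k : ℕ) {N : ℕ} (χ : DirichletCharacter ℂ N) (p : ℕ) : (ℕ → ℂ) →ₗ[ℂ] (ℕ → ℂ) where
  toFun a n := a (p ^ 2 * n)
    + χ (p : ZMod N) * (jacobiSym ((-1) ^ ((k - 1) / 2) * (n : ℤ)) p : ℂ) *
        (p : ℂ) ^ ((((k - 1) / 2 : ℕ) : ℤ) - 1) * a n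
    + χ ((p : ZMod N) ^ 2) * (p : ℂ) ^ ((k : ℤ) - 2) * (if p ^ 2 ∣ n then a (n / p ^ 2) else 0)
  map_add' a b := by
    funext n
    simp only [Pi.add_apply]
    split_ifs <;> ring
  map_smul' c a := by
    funext n
    simp only [Pi.smul_apply, smul_eq_mul, RingHom.id_apply]
    split_ifs <;> ring

/-- Unfolding `heckeTSq` (Shimura's formula). [cite: Shimura1973HalfIntegral, Thm. 1.7] -/
theorem heckeTSq_apply (k : ℕ) {N : ℕ} (χ : DirichletCharacter ℂ N) (p : ℕ) (a : ℕ → ℂ) (n : ℕ) :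
    heckeTSq k χ p a n = a (p ^ 2 * n)
      + χ (p : ZMod N) * (jacobiSym ((-1) ^ ((k - 1) / 2) * (n : ℤ)) p : ℂ) *
          (p : ℂ) ^ ((((k - 1) / 2 : ℕ) : ℤ) - 1) * a n
      + χ ((p : ZMod N) ^ 2) * (p : ℂ) ^ ((k : ℤ) - 2) *
          (if p ^ 2 ∣ n then a (n / p ^ 2) else 0) :=
  rfl

/-- For `p ∣ N`, `p ≠ 1`, the character vanishes at `p` and `T(p²)` is `a ↦ (n ↦ a(p² n))`
(Shimura 1973, Thm. 1.7, case `p ∣ N`). [folklore] -/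
theorem heckeTSq_apply_of_dvd (k : ℕ) {N : ℕ} (χ : DirichletCharacter ℂ N) {p : ℕ} (hp : p ≠ 1)
    (hpN : p ∣ N) (a : ℕ → ℂ) (n : ℕ) : heckeTSq k χ p a n = a (p ^ 2 * n) := by
  have hu : ¬ IsUnit (p : ZMod N) :=
    fun h ↦ hp (((ZMod.isUnit_iff_coprime p N).mp h).eq_one_of_dvd hpN)
  have h1 : χ (p : ZMod N) = 0 := MulChar.map_nonunit χ hu
  have h2 : χ ((p : ZMod N) ^ 2) = 0 := by rw [map_pow, h1]; ring
  simp [heckeTSq_apply, h1, h2]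

/-- In weight `3/2` (`k = 3`, `λ = 1`) the formula reads
`(T(p²) a)(n) = a(p² n) + χ(p) (-n/p) a(n) + χ(p²) p a(n/p²)`. [folklore] -/
theorem heckeTSq_three_apply {N : ℕ} (χ : DirichletCharacter ℂ N) (p : ℕ) (a : ℕ → ℂ) (n : ℕ) :
    heckeTSq 3 χ p a n = a (p ^ 2 * n) + χ (p : ZMod N) * (jacobiSym (-(n : ℤ)) p : ℂ) * a n
      + χ ((p : ZMod N) ^ 2) * p * (if p ^ 2 ∣ n then a (n / p ^ 2) else 0) := by
  simp [heckeTSq_apply]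

/-- **Shimura 1973, Theorem 1.7**: for `k` odd, `4 ∣ N` and `p` prime, the Hecke
operator `T(p²)` maps `M_{k/2}(N, χ)` to itself and `S_{k/2}(N, χ)` to itself, acting on
`q`-expansions by `heckeTSq` — i.e. for every `f` in the space there is `g` in the space with
`a_g = T(p²) a_f`. (Shimura defines `T(p²)` by the double coset `Δ₀(N) ξ Δ₀(N)`,
`ξ = (diag(1, p²), p^{1/2})`, and computes its `q`-expansion in Thm. 1.7.) Needs the theory of the
covering group; vendored as a named fact. [cite: Shimura1973HalfIntegral, Thm. 1.7] -/
def Shimura1973_heckeTSq_mem : Prop :=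
  ∀ (k N : ℕ) (χ : DirichletCharacter ℂ N) (p : ℕ), Odd k → 4 ∣ N → p.Prime →
    (∀ f ∈ halfIntModularForms k N χ,
      ∃ g ∈ halfIntModularForms k N χ, qCoeffs g = heckeTSq k χ p (qCoeffs f)) ∧
    (∀ f ∈ halfIntCuspForms k N χ,
      ∃ g ∈ halfIntCuspForms k N χ, qCoeffs g = heckeTSq k χ p (qCoeffs f))

/-! ### Waldspurger's subspace `S_{k/2}(N, χ, F)` -/

/-- `f ∈ S_{k/2}(N, χ)` **is a `T(p²)`-eigenform with the eigenvalues `ev p` for almost all primes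
`p ∤ N`**: there is a finite exceptional set `S` of primes outside which (and off the level)
`T(p²) f = ev(p) f`, stated on `q`-expansions. [cite: Purkait2014Fourier, §4.1] -/
def IsAlmostEigenform (k N : ℕ) (χ : DirichletCharacter ℂ N) (ev : ℕ → ℂ) (f : ℍ → ℂ) : Prop :=
  ∃ S : Finset ℕ, ∀ p : ℕ, p.Prime → p ∉ S → ¬ p ∣ N →
    heckeTSq k χ p (qCoeffs f) = ev p • qCoeffs f

/-- **Waldspurger's space `S_{k/2}(N, χ, F)`** of cusp forms of weight `k/2`, level `N` and
character `χ` *corresponding to `F` under Shimura's map*, where `F = ∑ λ_n qⁿ` is a normalised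
newform of weight `k - 1` with Hecke eigenvalues `ev p = λ_p`: the subspace of the
`f ∈ S_{k/2}(N, χ)` with `T(p²) f = λ_p f` for almost all primes `p ∤ N` (Waldspurger 1981, Thm 1;
restated in Purkait 2014, §4.1; Tunnell 1983, p. 328 (ii): "the forms of weight `k/2`, level `N`,
and character `χ` which correspond to `φ` via Shimura's map"). Realised as the span of that set
(which is already a subspace: `T(p²)` and `f ↦ a_f` are linear). Only the eigenvalue system `ev`
of `F` enters. For `k = 3` Waldspurger intersects with the orthogonal complement of the
one-variable theta series, which is automatic for cuspidal `ev` (module docstring).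
[cite: Waldspurger1981Fourier, Thm 1] [cite: Purkait2014Fourier, §4.1]
[cite: Tunnell1983Congruent, Theorem (Waldspurger) (ii), p. 328] -/
def shimuraSubspace (k N : ℕ) (χ : DirichletCharacter ℂ N) (ev : ℕ → ℂ) : Submodule ℂ (ℍ → ℂ) :=
  Submodule.span ℂ {f | f ∈ halfIntCuspForms k N χ ∧ IsAlmostEigenform k N χ ev f}

/-- `S_{k/2}(N, χ, F) ≤ S_{k/2}(N, χ)`. [folklore] -/
theorem shimuraSubspace_le_halfIntCuspForms (k N : ℕ) (χ : DirichletCharacter ℂ N) (ev : ℕ → ℂ) :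
    shimuraSubspace k N χ ev ≤ halfIntCuspForms k N χ :=
  Submodule.span_le.mpr fun _ hf ↦ hf.1

/-- An eigenform in `S_{k/2}(N, χ)` with the eigenvalues `ev p` for almost all `p ∤ N` lies in
`S_{k/2}(N, χ, F)`. [folklore] -/
theorem mem_shimuraSubspace_of_isAlmostEigenform {k N : ℕ} {χ : DirichletCharacter ℂ N}
    {ev : ℕ → ℂ} {f : ℍ → ℂ} (hf : f ∈ halfIntCuspForms k N χ)
    (he : IsAlmostEigenform k N χ ev f) : f ∈ shimuraSubspace k N χ ev :=
  Submodule.subset_span ⟨hf, he⟩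

/-- An eigenform of all `T(p²)`, `p ∤ N`, is an almost-eigenform. [folklore] -/
theorem isAlmostEigenform_of_forall {k N : ℕ} {χ : DirichletCharacter ℂ N} {ev : ℕ → ℂ}
    {f : ℍ → ℂ} (h : ∀ p : ℕ, p.Prime → ¬ p ∣ N → heckeTSq k χ p (qCoeffs f) = ev p • qCoeffs f) :
    IsAlmostEigenform k N χ ev f :=
  ⟨∅, fun p hp _ hpN ↦ h p hp hpN⟩

/-- The defining set of `S_{k/2}(N, χ, F)` is closed under addition (so the span adds nothing):
sums of almost-eigenforms in `S_{k/2}(N, χ)` are almost-eigenforms. [folklore] -/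
theorem IsAlmostEigenform.add {k N : ℕ} {χ : DirichletCharacter ℂ N} {ev : ℕ → ℂ}
    {f g : ℍ → ℂ} (hf : f ∈ halfIntCuspForms k N χ) (hg : g ∈ halfIntCuspForms k N χ)
    (hef : IsAlmostEigenform k N χ ev f) (heg : IsAlmostEigenform k N χ ev g) :
    IsAlmostEigenform k N χ ev (f + g) := by
  obtain ⟨S, hS⟩ := hef
  obtain ⟨S', hS'⟩ := heg
  refine ⟨S ∪ S', fun p hp hpS hpN ↦ ?_⟩
  rw [Finset.mem_union, not_or] at hpS
  rw [qCoeffs_add (halfIntCuspForms_le_halfIntModularForms k N χ hf)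
    (halfIntCuspForms_le_halfIntModularForms k N χ hg), map_add, smul_add,
    hS p hp hpS.1 hpN, hS' p hp hpS.2 hpN]

/-- Scalar multiples of almost-eigenforms are almost-eigenforms. [folklore] -/
theorem IsAlmostEigenform.smul {k N : ℕ} {χ : DirichletCharacter ℂ N} {ev : ℕ → ℂ}
    {f : ℍ → ℂ} (hf : f ∈ halfIntCuspForms k N χ) (hef : IsAlmostEigenform k N χ ev f) (c : ℂ) :
    IsAlmostEigenform k N χ ev (c • f) := by
  obtain ⟨S, hS⟩ := hef
  refine ⟨S, fun p hp hpS hpN ↦ ?_⟩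
  rw [qCoeffs_smul (halfIntCuspForms_le_halfIntModularForms k N χ hf), map_smul,
    hS p hp hpS hpN, smul_comm]

/-- Every member of `S_{k/2}(N, χ, F)` is an almost-eigenform with the eigenvalues of `F` (the
span in `shimuraSubspace` adds nothing). [folklore] -/
theorem isAlmostEigenform_of_mem_shimuraSubspace {k N : ℕ} {χ : DirichletCharacter ℂ N}
    {ev : ℕ → ℂ} {f : ℍ → ℂ} (hf : f ∈ shimuraSubspace k N χ ev) :
    IsAlmostEigenform k N χ ev f := by
  induction hf using Submodule.span_induction with
  | mem x hx => exact hx.2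
  | zero => exact ⟨∅, fun p _ _ _ ↦ by simp⟩
  | add x y hx hy hex hey =>
    exact hex.add (shimuraSubspace_le_halfIntCuspForms k N χ ev hx)
      (shimuraSubspace_le_halfIntCuspForms k N χ ev hy) hey
  | smul c x hx hex => exact hex.smul (shimuraSubspace_le_halfIntCuspForms k N χ ev hx) c

/-- Membership in `S_{k/2}(N, χ, F)` is exactly: cusp form of weight `k/2` and almost-eigenform
for `F`. [folklore] -/
theorem mem_shimuraSubspace_iff {k N : ℕ} {χ : DirichletCharacter ℂ N} {ev : ℕ → ℂ}
    {f : ℍ → ℂ} :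
    f ∈ shimuraSubspace k N χ ev ↔ f ∈ halfIntCuspForms k N χ ∧ IsAlmostEigenform k N χ ev f :=
  ⟨fun h ↦ ⟨shimuraSubspace_le_halfIntCuspForms k N χ ev h, isAlmostEigenform_of_mem_shimuraSubspace h⟩,
    fun h ↦ mem_shimuraSubspace_of_isAlmostEigenform h.1 h.2⟩

end Literature.NumberTheory.EllipticCurves.ModularForms
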